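import Summits.QuantumFields.YangMills.Theses.FluxSectorLaplace
import Summits.QuantumFields.YangMills.Theorems.QuantileBitPuritySectors
import HarnessLib

/-!
# Route `FluxSectorLaplace` (YangMills): the support item `SectorDecomposition` (stmt-QuantumFields-24081) holds BY NAME

`SectorDecomposition := ∀ L [NeZero L] β n A, MeasurableSet A →
  TT.ringInsTrace L β n 𝟙_A 0 = (1/8) Σ_{z : Fin 3 → Bool} TT.sectorWeight β n z (𝟙_A(U₀))` — the exact decomposition of the
un-normalised thermal weight of a slice-`0` event over the eight seam (centre-twist) sectors of the zero-flux ring, one Fubini on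
`physAvg = (1/8) Σ_z ∫ dg`.  This is `TT.ringInsTrace_indicator_zero_eq_sum_sectorWeight` of the landed module
`QuantileBitPuritySectors` (seat ym-dw-p1 g14, p694102), restated by the route verbatim; this file closes the item by name.

HONEST FRAMING: fixed-lattice bookkeeping (a by-name bridge); the route's cruxes `FluxSectorSuppression` /
`PeriodicCoreRaritySubQuartic` are OPEN; no summit conjunct is touched; the Yang–Mills mass gap is NOT proved.
No `sorry`, no new axiom, no new definition.  References: [cite: MontvayMunster1994, (3.145)]; [cite: Luscher1983, §2].
-/

set_option autoImplicit false

namespace Summit.QuantumFields.YangMills.Theorems.FluxSectorLaplace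

/-- **`SectorDecomposition` holds** (item stmt-QuantumFields-24081 of route `FluxSectorLaplace`, BY NAME): for every `L`, `β`, `n`
and measurable slice event `A`, `TT.ringInsTrace L β n 𝟙_A 0 = (1/8) Σ_z TT.sectorWeight β n z (𝟙_A(U₀))` — the instance of
`TT.ringInsTrace_indicator_zero_eq_sum_sectorWeight`.  [cite: MontvayMunster1994, (3.145)] [cite: Luscher1983, §2] -/
theorem sectorDecomposition_proof :
    Summit.QuantumFields.YangMills.Theses.FluxSectorLaplace.SectorDecomposition :=
  fun _L _ β n _A hA => FemtoTransferGap.TT.ringInsTrace_indicator_zero_eq_sum_sectorWeight β n hA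

end Summit.QuantumFields.YangMills.Theorems.FluxSectorLaplace
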